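import Mathlib
import Summits.Parity.GeneralizedHardyLittlewood.Theses.LiouvilleShiftedTables

/-!
# Sketch — crux-ideate stmt-Parity-14270 (TableChowla), ideator 3, round 1

First-lemma signatures for the idea cards `slope-band-vdc` and `corner-local-box`,
plus the calibration statement `tableChowla_fixedResidueFace` (obstruction side, evidence).
Everything is stated over the route's own decl
`Summit.Parity.GeneralizedHardyLittlewood.Theses.LiouvilleShiftedTables.TableChowla`.
-/

namespace Summit.Parity.GeneralizedHardyLittlewood.Cruxes.TableChowla.Sketch

open Summit.Parity.GeneralizedHardyLittlewood.Theses.LiouvilleShiftedTables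
open Finset

noncomputable section

/-- `λ(n)` as a real number at an integer argument, with the route's `Int.toNat` convention
(negative arguments ↦ `λ(0) = 0`). -/
def lam (n : ℤ) : ℝ := (ArithmeticFunction.liouville (Int.toNat n) : ℝ)

/-- The pair (two-point, dilation-pair) sum `S_c(a,a';B) = Σ_{b ≤ B} λ(ab+c) λ(a'b+c)`:
the `(a,a')` entry of the Gram matrix `M_c M_cᵀ` of the shifted multiplication table. -/
def pairSum (c : ℤ) (a a' B : ℕ) : ℝ :=
  ∑ b ∈ Icc 1 B, lam ((a : ℤ) * b + c) * lam ((a' : ℤ) * b + c)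

/-- The corner (2×2-block) sum `𝒞_c(h,k;A,B) = Σ_{a ∈ (A,2A]} Σ_{b ≤ B}
λ(ab+c) λ(a(b+k)+c) λ((a+h)b+c) λ((a+h)(b+k)+c)`.  `𝒞(0,k)` is the column-lag-`k` flat face
`Σ_a Σ_{n ≡ c (a)} λ(n)λ(n+ka)`, `𝒞(h,0)` the row-lag-`h` flat face `Σ_b Σ_a λ(ab+c)λ((a+h)b+c)`,
and `Σ_{h,k}` over ALL differences is the fourth moment `tr (M_cM_cᵀ)²` of the crux. -/
def cornerSum (c : ℤ) (h k Alo Ahi B : ℕ) : ℝ :=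
  ∑ a ∈ Ioc Alo Ahi, ∑ b ∈ Icc 1 B,
    lam ((a : ℤ) * b + c) * lam ((a : ℤ) * (b + k) + c) *
      lam (((a : ℤ) + h) * b + c) * lam (((a : ℤ) + h) * (b + k) + c)

/-- **Determinant identity of the shifted table** (why every corner sum is a two-point
Chowla sum at shift `hkc`): for the 2×2 block with row gap `h` and column gap `k`,
`(ab+c)((a+h)(b+k)+c) − ((a+h)b+c)(a(b+k)+c) = hkc`. -/
theorem block_det (a b c h k : ℤ) :
    (a * b + c) * ((a + h) * (b + k) + c) - ((a + h) * b + c) * (a * (b + k) + c)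
      = h * k * c := by
  ring

/-- Card `slope-band-vdc`, transfer target `C⁺`: **BandChowla** — only slope pairs
`(a, a+h)` with `1 ≤ h ≤ (log x)^K` are asked to be small in mean square, with per-pair
budget `B²(log x)^{1-K}` (`B = x/A`): `Σ_{h ≤ (log x)^K} Σ_{a ∈ (A,2A]} S_c(a,a+h;⌊x/A⌋)²
≤ x² log x / A`. Van der Corput across the slope family gives `BandChowla → TableChowla`
(`band_reduction`); `BandChowla` is STRONGER (the crux bounds band pairs only inside the average
over all `A²` pairs) and holds in the random model with room `B (log x)^{K-1}`. -/
def BandChowla : Prop :=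
  ∀ c : ℤ, c ≠ 0 → ∀ δ : ℝ, 0 < δ → δ ≤ 1 / 12 → ∀ K : ℝ, 0 < K → ∃ x₀ : ℝ, ∀ x : ℝ, x₀ ≤ x →
    ∀ A : ℝ, x ^ δ ≤ A → A ≤ x ^ (1 / 3 + δ) →
      (∑ h ∈ Icc 1 ⌊Real.log x ^ K⌋₊, ∑ a ∈ Ioc ⌊A⌋₊ ⌊2 * A⌋₊,
          (pairSum c a (a + h) ⌊x / A⌋₊) ^ 2) ≤ x ^ 2 * Real.log x / A

/-- **First lemma of card `slope-band-vdc`** (van der Corput in the row variable applied to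
the column-pair sums `G(b,b') = Σ_a λ(ab+c)λ(ab'+c)`, then summed over `(b,b')`):
`E ≤ ((N+H)/H)·[N·B² + 2 Σ_{1≤h<H} Σ_a S(a,a+h)²]` with `H = ⌊(log x)^{C+2}⌋`, `K = C+2`. -/
theorem band_reduction : BandChowla → TableChowla := by
  sorry

/-- Card `corner-local-box`, transfer target: **LocalBoxChowla** — every local corner sum
with gaps `(h,k) ∈ [0,(log x)^K]² ∖ {(0,0)}` has a log-power saving:
`|𝒞_c(h,k;A,⌊x/A⌋)| ≤ x/(log x)^K`.  The cases `h = 0` / `k = 0` are the two flat faces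
(column-lag Chowla along APs of small modulus `a`; row-lag Chowla along APs of large
modulus `b` = the fixed-residue level-of-distribution face). -/
def LocalBoxChowla : Prop :=
  ∀ c : ℤ, c ≠ 0 → ∀ δ : ℝ, 0 < δ → δ ≤ 1 / 12 → ∀ K : ℝ, 0 < K → ∃ x₀ : ℝ, ∀ x : ℝ, x₀ ≤ x →
    ∀ A : ℝ, x ^ δ ≤ A → A ≤ x ^ (1 / 3 + δ) → ∀ h k : ℕ, (h : ℝ) ≤ Real.log x ^ K →
      (k : ℝ) ≤ Real.log x ^ K → (h, k) ≠ (0, 0) →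
        |cornerSum c h k ⌊A⌋₊ ⌊2 * A⌋₊ ⌊x / A⌋₊| ≤ x / Real.log x ^ K

/-- **First lemma of card `corner-local-box`** (double van der Corput = local box norm:
`E ≤ ((N+H)/H)((B+H)/H) Σ_{|h|,|k|<H} (1-|h|/H)(1-|k|/H) 𝒞(h,k)`, `H = ⌊(log x)^{C+1}⌋`). -/
theorem localBox_reduction : LocalBoxChowla → TableChowla := by
  sorry

/-- **Calibration (obstruction side).** `TableChowla` implies the fixed-residue, ℓ¹-over-moduli
level-of-distribution statement for `λ` at level `1 − δ`: for `A = x^δ` the moduli `b` run up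
to `x^{1-δ}` and each progression `{ab+c : a ∈ (A,2A]} = {n ≡ c (b)} ∩ (Ab, 2Ab]` has `x^δ`
terms. Proof: two Cauchy–Schwarz steps, `(Σ_b |T_b|)² ≤ B Σ_b T_b² = B Σ_{a,a'} S(a,a')
≤ B·N·(Σ S²)^{1/2}`. -/
theorem tableChowla_fixedResidueFace (hT : TableChowla) :
    ∀ c : ℤ, c ≠ 0 → ∀ δ : ℝ, 0 < δ → δ ≤ 1 / 12 → ∀ C : ℝ, 0 < C → ∃ x₀ : ℝ, ∀ x : ℝ, x₀ ≤ x →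
      ∀ A : ℝ, x ^ δ ≤ A → A ≤ x ^ (1 / 3 + δ) →
        (∑ b ∈ Icc 1 ⌊x / A⌋₊, |∑ a ∈ Ioc ⌊A⌋₊ ⌊2 * A⌋₊, lam ((a : ℤ) * b + c)|)
          ≤ x / Real.log x ^ C := by
  sorry

/-- Sanity: the crux decl is the one we talk about (q = 1 table, by name). -/
example : TableChowla ↔
    (∀ c : ℤ, c ≠ 0 → ∀ δ : ℝ, 0 < δ → δ ≤ 1 / 12 → ∀ C : ℝ, 0 < C → ∃ x₀ : ℝ, ∀ x : ℝ, x₀ ≤ x →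
      ∀ A : ℝ, x ^ δ ≤ A → A ≤ x ^ (1 / 3 + δ) →
        (∑ a ∈ Finset.Ioc ⌊A⌋₊ ⌊2 * A⌋₊, ∑ a' ∈ Finset.Ioc ⌊A⌋₊ ⌊2 * A⌋₊,
          (∑ b ∈ Finset.Icc 1 ⌊x / A⌋₊,
            (ArithmeticFunction.liouville (Int.toNat ((a : ℤ) * b + c)) : ℝ) *
              (ArithmeticFunction.liouville (Int.toNat ((a' : ℤ) * b + c)) : ℝ)) ^ 2)
          ≤ x ^ 2 / Real.log x ^ C) :=
  Iff.rfl

end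

end Summit.Parity.GeneralizedHardyLittlewood.Cruxes.TableChowla.Sketch
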